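import Mathlib
import HarnessLib
import Summits.ValiantsHypothesis.ValiantsHypothesis.Theorems.LacunarySymmetroidMatrixDescartesOsculationLawCuspNonMonic
import Summits.ValiantsHypothesis.ValiantsHypothesis.Theorems.LacunarySymmetroidMatrixDescartesOsculationLawTwoKCusp
import Summits.ValiantsHypothesis.ValiantsHypothesis.Theorems.LacunarySymmetroidMatrixDescartesFoldLawTwoKCurve

/-!
# `MatrixDescartes` (stmt-ValiantsHypothesis-18050, V1), line «osculation-law» — the CUSP COUNT for a NON-MONIC
# quadratic letter `Ψ = a(t)·b² + m(t)·b + δ(t)`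

Toward the `(r,s) = (2,1)` splitting of `OsculationLawAt 3 K ·` (line file `Cruxes/MatrixDescartes/Lines/osculation_law.lean`):
the rank-two letter `b·(I₂ ⊕ 0)` inserted into a symmetric `3 × 3` pencil gives `Φ(t,b) = a(t)·b² + m(t)·b + δ(t)` with
`a = det G₂₂` a SIGNED `K`-nomial (NOT monic in `b`, unlike the `(2,0)` splitting of `…OsculationLawTwoKCusp`).  This
file counts the osculation set `{t > 0, b > 0, Ψ = 0, H(Ψ) = 0}` of the abstract curve `Ψ = X₁X₁·ι a + X₁·ι m + ι δ`
(`ι : X ↦ X₀`) for ARBITRARY `a m δ : ℝ[X]` with `a ≢ 0` and `m(t)² ≥ 4a(t)δ(t)` on `ℝ` (real `b`-roots, as for a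
symmetric pencil), given ANY pair `U, V : ℝ[X]` with `a(t)⁴·H(t,b) = U(t)·b + V(t)` on the curve (the tree's
`OsculationCuspGen.hess_reduce_poly`, p605555, supplies the explicit pair of weights `12`, `13`):

* `exists_pos_root` — a real-rooted quadratic `A b² + M b + D`, `A ≠ 0`, with `MA < 0` or `DA < 0` has a root `b > 0`
  (Vieta signs: every continuity-of-roots argument becomes an OPEN SIGN CONDITION on the abscissa);
* `nonmonic_cusp_ncard_le` (**main**): a finite osculation set has `≤ |supp N| + 2·|supp U| + 2·|supp V|` points,
  `N = a·V² − m·U·V + δ·U²`.  On the set `U(t)·b + V(t) = 0` and `N(t) = 0` (`OsculationCuspGen.resultant_step`);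
  points with `U(t) ≠ 0` project injectively to positive roots of `N`; points with `U(t) = 0` have `V(t) = 0` and at
  most two ordinates (the fibre `a(t)X² + m(t)X + δ(t)` is nonzero: `a(t) = m(t) = 0` forces `δ(t) = 0` and puts the
  VERTICAL RAY `{t} × (0,∞)` in the set).  The degenerate sub-cases `N ≡ 0` (points `(t, −V/U)` over `{U·V < 0}`) and
  `U ≡ V ≡ 0` (over the open sign set `{ma < 0} ∪ {δa < 0} ∪ {mδ < 0}`, which contains every osculation abscissa,
  `Ψ(t,·)` has a positive root and `H = 0` there) give open arcs of osculation points over `{a ≠ 0}` — excluded by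
  finiteness (an open set minus the finite zero set of `a` is nonempty).

Honest framing.  A counting lemma (helper, `--supports`) for one splitting of the `m = 3` rung of an UNREGISTERED V1
law line; the monomial counts and the pencil identification follow in `…OsculationLawThreeKTwoOne`.  It does not
touch `OsculationLaw` (all `m`), `stub_peel`, `stub_recursion`, `MatrixDescartes`, Conjecture B or `VP ≠ VNP` (all
OPEN / NOT proved); nothing here is progress on them.  No definitions, no named facts; Mathlib + the tree files
`…OsculationLawCuspNonMonic` (`eval_logHessian_Psi`, `resultant_step`), `…TwoKCusp` (`OsculationCusp.infinite_of_curve`),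
`…FoldLawTwoKCurve` (`FoldCurve.eval_Psi`), `…TwoKRankOne` (`OsculationRankOne.card_roots_filter_pos_le_card_support`).
-/

-- `Summit.ValiantsHypothesis.ValiantsHypothesis.…` is the tree's mandated single-conjunct layout (Sub = Summit).
set_option linter.dupNamespace false

noncomputable section

namespace Summit.ValiantsHypothesis.ValiantsHypothesis.Theorems.LacunarySymmetroidMatrixDescartes

open Polynomial Set
open scoped BigOperators

namespace OsculationCuspGen

/-- **Positive root from a sign.**  A real-rooted quadratic `A b² + M b + D` (`A ≠ 0`, `M² ≥ 4AD`) with `M·A < 0`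
(positive root sum) or `D·A < 0` (negative root product) has a root `b > 0`. [folklore] -/
theorem exists_pos_root (A M D : ℝ) (hA : A ≠ 0) (hdisc : 4 * (A * D) ≤ M ^ 2)
    (h : M * A < 0 ∨ D * A < 0) : ∃ b : ℝ, 0 < b ∧ A * b ^ 2 + M * b + D = 0 := by
  obtain ⟨s, hss⟩ : ∃ s : ℝ, s * s = M ^ 2 - 4 * (A * D) :=
    ⟨Real.sqrt (M ^ 2 - 4 * (A * D)), Real.mul_self_sqrt (by linarith)⟩
  have hdis : discrim A M D = s * s := by rw [hss, discrim]; ring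
  obtain ⟨r₁, hr₁⟩ : ∃ r : ℝ, r = (-M + s) / (2 * A) := ⟨_, rfl⟩
  obtain ⟨r₂, hr₂⟩ : ∃ r : ℝ, r = (-M - s) / (2 * A) := ⟨_, rfl⟩
  have hroot₁ : A * r₁ ^ 2 + M * r₁ + D = 0 := by
    rw [sq]; exact (quadratic_eq_zero_iff hA hdis r₁).2 (Or.inl hr₁)
  have hroot₂ : A * r₂ ^ 2 + M * r₂ + D = 0 := by
    rw [sq]; exact (quadratic_eq_zero_iff hA hdis r₂).2 (Or.inr hr₂)
  have e1 : 2 * A * r₁ = -M + s := by rw [hr₁]; field_simp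
  have e2 : 2 * A * r₂ = -M - s := by rw [hr₂]; field_simp
  by_contra hcon
  have h1 : r₁ ≤ 0 := not_lt.1 fun hlt => hcon ⟨r₁, hlt, hroot₁⟩
  have h2 : r₂ ≤ 0 := not_lt.1 fun hlt => hcon ⟨r₂, hlt, hroot₂⟩
  rcases h with h | h
  · have hsum : M * A = -(A * A) * (r₁ + r₂) := by linear_combination (A / 2) * (e1 + e2)
    have : 0 ≤ M * A := by
      rw [hsum]
      exact mul_nonneg_of_nonpos_of_nonpos (by nlinarith [mul_self_nonneg A]) (by linarith)
    linarith
  · have e12 : (2 * A * r₁) * (2 * A * r₂) = (-M + s) * (-M - s) := by rw [e1, e2]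
    have hprod : A * A * (r₁ * r₂) = A * D := by
      linear_combination (1 / 4 : ℝ) * e12 - (1 / 4 : ℝ) * hss
    have : 0 ≤ D * A := by
      have : D * A = A * A * (r₁ * r₂) := by linarith
      rw [this]
      exact mul_nonneg (mul_self_nonneg A) (mul_nonneg_of_nonpos_of_nonpos h1 h2)
    linarith

/-- An open set of reals containing a point is not covered by a finite set. [folklore] -/
theorem exists_mem_open_not_mem_finite {U F : Set ℝ} (hU : IsOpen U) {t₀ : ℝ} (ht₀ : t₀ ∈ U)
    (hF : F.Finite) : ∃ t ∈ U, t ∉ F := by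
  obtain ⟨ε, hε, hball⟩ := Metric.isOpen_iff.1 hU t₀ ht₀
  have hinf : (Set.Ioo (t₀ - ε) (t₀ + ε)).Infinite := Set.Ioo_infinite (by linarith)
  obtain ⟨t, ht⟩ := (hinf.sdiff hF).nonempty
  refine ⟨t, hball ?_, ht.2⟩
  rw [Real.ball_eq_Ioo]
  exact ht.1

/-- A vertical ray `{t₀} × (0,∞)` inside a set of the plane makes it infinite. [folklore] -/
theorem infinite_of_vertical {osc : Set (Fin 2 → ℝ)} (t₀ : ℝ)
    (h : ∀ b : ℝ, 0 < b → (![t₀, b] : Fin 2 → ℝ) ∈ osc) : osc.Infinite := by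
  refine Set.infinite_of_injOn_mapsTo (f := fun b : ℝ => (![t₀, b] : Fin 2 → ℝ)) (s := Set.Ioi (0 : ℝ)) ?_
    (fun b hb => h b hb) (Set.Ioi_infinite 0)
  intro b _ b' _ hbb'
  have := congr_fun hbb' 1
  simpa [Matrix.cons_val_one, Matrix.head_cons] using this

/-! ### The cusp count for the non-monic quadratic letter -/

/-- **Cusp curve, non-monic letter.**  For `Ψ = X₁X₁·ι a + X₁·ι m + ι δ` with `a ≢ 0`, `m² ≥ 4aδ` on `ℝ`, and a pair
`U, V` with `a(t)⁴·H(Ψ)(t,b) = U(t)·b + V(t)` on the curve (`θ₀ = t∂ₜ`, `θ₁ = b∂_b`; `H` in values as in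
`OsculationCuspGen.eval_logHessian_Psi`), a finite osculation set has at most `|supp N| + 2|supp U| + 2|supp V|`
points, `N = a·V² − m·U·V + δ·U²`. -/
theorem nonmonic_cusp_ncard_le (a m δ U V : ℝ[X]) (Φ : MvPolynomial (Fin 2) ℝ)
    (hΦ : Φ = (MvPolynomial.X 1 * MvPolynomial.X 1 * Polynomial.aeval (MvPolynomial.X 0 : MvPolynomial (Fin 2) ℝ) a + MvPolynomial.X 1 * Polynomial.aeval (MvPolynomial.X 0 : MvPolynomial (Fin 2) ℝ) m + Polynomial.aeval (MvPolynomial.X 0 : MvPolynomial (Fin 2) ℝ) δ))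
    (ha : a ≠ 0) (hdisc : ∀ t : ℝ, 4 * (a.eval t * δ.eval t) ≤ m.eval t ^ 2)
    (hUV : ∀ t b : ℝ, a.eval t * b ^ 2 + m.eval t * b + δ.eval t = 0 →
      a.eval t ^ 4 * ((4 : ℝ) * b ^ 6 * a.eval t ^ 2 * (t * (derivative a).eval t + t ^ 2 * (derivative (derivative a)).eval t) - (4 : ℝ) * b ^ 6 * a.eval t * (t * (derivative a).eval t) ^ 2 + (4 : ℝ) * b ^ 5 * a.eval t ^ 2 * (t * (derivative m).eval t + t ^ 2 * (derivative (derivative m)).eval t) + (4 : ℝ) * b ^ 5 * a.eval t * m.eval t * (t * (derivative a).eval t + t ^ 2 * (derivative (derivative a)).eval t) - (4 : ℝ) * b ^ 5 * a.eval t * (t * (derivative a).eval t) * (t * (derivative m).eval t) - (3 : ℝ) * b ^ 5 * m.eval t * (t * (derivative a).eval t) ^ 2 + (4 : ℝ) * b ^ 4 * a.eval t ^ 2 * (t * (derivative δ).eval t + t ^ 2 * (derivative (derivative δ)).eval t) + (4 : ℝ) * b ^ 4 * a.eval t * m.eval t * (t * (derivative m).eval t + t ^ 2 * (derivative (derivative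 m)).eval t) + b ^ 4 * m.eval t ^ 2 * (t * (derivative a).eval t + t ^ 2 * (derivative (derivative a)).eval t) - (4 : ℝ) * b ^ 4 * m.eval t * (t * (derivative a).eval t) * (t * (derivative m).eval t) + (4 : ℝ) * b ^ 3 * a.eval t * m.eval t * (t * (derivative δ).eval t + t ^ 2 * (derivative (derivative δ)).eval t) + (4 : ℝ) * b ^ 3 * a.eval t * (t * (derivative m).eval t) * (t * (derivative δ).eval t) + b ^ 3 * m.eval t ^ 2 * (t * (derivative m).eval t + t ^ 2 * (derivative (derivative m)).eval t) - (2 : ℝ) * b ^ 3 * m.eval t * (t * (derivative a).eval t) * (t * (derivative δ).eval t) - b ^ 3 * m.eval t * (t * (derivative m).eval t) ^ 2 + (4 : ℝ) * b ^ 2 * a.eval t * (t * (derivative δ).eval t) ^ 2 + b ^ 2 * m.eval t ^ 2 * (t * (derivative δ).eval t + t ^ 2 * (derivative (derivative δ)).eval t) + b * m.eval t * (t * (derivative δ).eval t) ^ 2) = U.eval t * b + V.eval t)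
    (hfin : {p : Fin 2 → ℝ | 0 < p 0 ∧ 0 < p 1 ∧ MvPolynomial.eval p Φ = 0 ∧
      MvPolynomial.eval p
        (MvPolynomial.X 0 * MvPolynomial.pderiv 0 (MvPolynomial.X 0 * MvPolynomial.pderiv 0 Φ)
            * (MvPolynomial.X 1 * MvPolynomial.pderiv 1 Φ) ^ 2
          - 2 * (MvPolynomial.X 0 * MvPolynomial.pderiv 0 (MvPolynomial.X 1 * MvPolynomial.pderiv 1 Φ))
            * (MvPolynomial.X 0 * MvPolynomial.pderiv 0 Φ) * (MvPolynomial.X 1 * MvPolynomial.pderiv 1 Φ)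
          + MvPolynomial.X 1 * MvPolynomial.pderiv 1 (MvPolynomial.X 1 * MvPolynomial.pderiv 1 Φ)
            * (MvPolynomial.X 0 * MvPolynomial.pderiv 0 Φ) ^ 2) = 0}.Finite) :
    {p : Fin 2 → ℝ | 0 < p 0 ∧ 0 < p 1 ∧ MvPolynomial.eval p Φ = 0 ∧
      MvPolynomial.eval p
        (MvPolynomial.X 0 * MvPolynomial.pderiv 0 (MvPolynomial.X 0 * MvPolynomial.pderiv 0 Φ)
            * (MvPolynomial.X 1 * MvPolynomial.pderiv 1 Φ) ^ 2
          - 2 * (MvPolynomial.X 0 * MvPolynomial.pderiv 0 (MvPolynomial.X 1 * MvPolynomial.pderiv 1 Φ))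
            * (MvPolynomial.X 0 * MvPolynomial.pderiv 0 Φ) * (MvPolynomial.X 1 * MvPolynomial.pderiv 1 Φ)
          + MvPolynomial.X 1 * MvPolynomial.pderiv 1 (MvPolynomial.X 1 * MvPolynomial.pderiv 1 Φ)
            * (MvPolynomial.X 0 * MvPolynomial.pderiv 0 Φ) ^ 2) = 0}.ncard ≤
      (a * V ^ 2 - m * U * V + δ * U ^ 2).support.card + 2 * U.support.card + 2 * V.support.card := by
  classical
  set N : ℝ[X] := a * V ^ 2 - m * U * V + δ * U ^ 2 with hN
  set osc := {p : Fin 2 → ℝ | 0 < p 0 ∧ 0 < p 1 ∧ MvPolynomial.eval p Φ = 0 ∧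
      MvPolynomial.eval p
        (MvPolynomial.X 0 * MvPolynomial.pderiv 0 (MvPolynomial.X 0 * MvPolynomial.pderiv 0 Φ)
            * (MvPolynomial.X 1 * MvPolynomial.pderiv 1 Φ) ^ 2
          - 2 * (MvPolynomial.X 0 * MvPolynomial.pderiv 0 (MvPolynomial.X 1 * MvPolynomial.pderiv 1 Φ))
            * (MvPolynomial.X 0 * MvPolynomial.pderiv 0 Φ) * (MvPolynomial.X 1 * MvPolynomial.pderiv 1 Φ)
          + MvPolynomial.X 1 * MvPolynomial.pderiv 1 (MvPolynomial.X 1 * MvPolynomial.pderiv 1 Φ)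
            * (MvPolynomial.X 0 * MvPolynomial.pderiv 0 Φ) ^ 2) = 0} with hosc
  /- (1) From the set to real numbers: positivity, the curve equation, `U(t)·b + V(t) = 0`, `N(t) = 0`. -/
  have from_osc : ∀ p ∈ osc, 0 < p 0 ∧ 0 < p 1 ∧
      a.eval (p 0) * p 1 ^ 2 + m.eval (p 0) * p 1 + δ.eval (p 0) = 0 ∧
      U.eval (p 0) * p 1 + V.eval (p 0) = 0 := by
    intro p hp
    obtain ⟨h0, h1, hΦ0, hH0⟩ := hp
    rw [hΦ, FoldCurve.eval_Psi] at hΦ0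
    rw [eval_logHessian_Psi a m δ Φ hΦ p _ _ _ _ _ _ _ _ rfl rfl rfl rfl rfl rfl rfl rfl] at hH0
    have hred := hUV (p 0) (p 1) hΦ0
    rw [hH0, mul_zero] at hred
    exact ⟨h0, h1, hΦ0, hred.symm⟩
  have N_root : ∀ p ∈ osc, N.IsRoot (p 0) := by
    intro p hp
    obtain ⟨-, -, hΨ0, hl⟩ := from_osc p hp
    have := resultant_step (a.eval (p 0)) (m.eval (p 0)) (δ.eval (p 0)) (U.eval (p 0)) (V.eval (p 0)) (p 1) hΨ0 hl
    rw [IsRoot.def, hN]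
    simp only [eval_sub, eval_add, eval_mul, eval_pow]
    linear_combination this
  /- (2) From real numbers to the set (over `{a ≠ 0}`). -/
  have mem_of : ∀ p : Fin 2 → ℝ, 0 < p 0 → 0 < p 1 → a.eval (p 0) ≠ 0 →
      a.eval (p 0) * p 1 ^ 2 + m.eval (p 0) * p 1 + δ.eval (p 0) = 0 →
      U.eval (p 0) * p 1 + V.eval (p 0) = 0 → p ∈ osc := by
    intro p h0 h1 hap hΨ0 hl
    refine ⟨h0, h1, ?_, ?_⟩
    · rw [hΦ, FoldCurve.eval_Psi]; exact hΨ0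
    · rw [eval_logHessian_Psi a m δ Φ hΦ p _ _ _ _ _ _ _ _ rfl rfl rfl rfl rfl rfl rfl rfl]
      have hred := hUV (p 0) (p 1) hΨ0
      rw [hl] at hred
      exact (mul_eq_zero.1 hred).resolve_left (pow_ne_zero 4 hap)
  /- (3) The vertical ray: an abscissa with `a(t) = m(t) = δ(t) = 0` carries every `b > 0`. -/
  have mem_vert : ∀ p : Fin 2 → ℝ, 0 < p 0 → 0 < p 1 → a.eval (p 0) = 0 → m.eval (p 0) = 0 →
      δ.eval (p 0) = 0 → p ∈ osc := by
    intro p h0 h1 ha0 hm0 hδ0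
    refine ⟨h0, h1, ?_, ?_⟩
    · rw [hΦ, FoldCurve.eval_Psi, ha0, hm0, hδ0]; ring
    · rw [eval_logHessian_Psi a m δ Φ hΦ p _ _ _ _ _ _ _ _ rfl rfl rfl rfl rfl rfl rfl rfl, ha0, hm0]; ring
  have no_vert : ∀ p ∈ osc, ¬ (a.eval (p 0) = 0 ∧ m.eval (p 0) = 0) := by
    rintro p hp ⟨ha0, hm0⟩
    obtain ⟨h0, -, hΨ0, -⟩ := from_osc p hp
    have hδ0 : δ.eval (p 0) = 0 := by rw [ha0, hm0] at hΨ0; linarith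
    apply hfin.not_infinite
    refine infinite_of_vertical (p 0) fun b hb => mem_vert _ ?_ ?_ ?_ ?_ ?_ <;>
      simp only [Matrix.cons_val_zero, Matrix.cons_val_one]
    exacts [h0, hb, ha0, hm0, hδ0]
  /- (4) The open sign set: over it, `Ψ(t,·)` has a positive root. -/
  have sign_of_mem : ∀ p ∈ osc, m.eval (p 0) * a.eval (p 0) < 0 ∨ δ.eval (p 0) * a.eval (p 0) < 0 ∨
      m.eval (p 0) * δ.eval (p 0) < 0 := by
    intro p hp
    obtain ⟨-, h1, hΨ0, -⟩ := from_osc p hp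
    by_cases hap : a.eval (p 0) = 0
    · have hmp : m.eval (p 0) ≠ 0 := fun hm0 => no_vert p hp ⟨hap, hm0⟩
      right; right
      have : δ.eval (p 0) = -(m.eval (p 0) * p 1) := by rw [hap] at hΨ0; linarith
      rw [this]
      have : 0 < m.eval (p 0) * m.eval (p 0) * p 1 := mul_pos (mul_self_pos.2 hmp) h1
      nlinarith
    · by_contra hcon
      have hma : 0 ≤ m.eval (p 0) * a.eval (p 0) := not_lt.1 fun h => hcon (Or.inl h)
      have hδa : 0 ≤ δ.eval (p 0) * a.eval (p 0) := not_lt.1 fun h => hcon (Or.inr (Or.inl h))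
      have hsq : 0 < a.eval (p 0) * a.eval (p 0) * (p 1 * p 1) := mul_pos (mul_self_pos.2 hap) (mul_pos h1 h1)
      have key : a.eval (p 0) * (a.eval (p 0) * p 1 ^ 2 + m.eval (p 0) * p 1 + δ.eval (p 0)) = 0 := by
        rw [hΨ0, mul_zero]
      nlinarith
  have pos_root_of_sign : ∀ t : ℝ, a.eval t ≠ 0 →
      (m.eval t * a.eval t < 0 ∨ δ.eval t * a.eval t < 0 ∨ m.eval t * δ.eval t < 0) →
      ∃ b : ℝ, 0 < b ∧ a.eval t * b ^ 2 + m.eval t * b + δ.eval t = 0 := by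
    intro t hat hsgn
    apply exists_pos_root _ _ _ hat (hdisc t)
    rcases hsgn with h | h | h
    · exact Or.inl h
    · exact Or.inr h
    · have hprod : (m.eval t * a.eval t) * (δ.eval t * a.eval t) < 0 := by
        have : (m.eval t * a.eval t) * (δ.eval t * a.eval t) = (m.eval t * δ.eval t) * (a.eval t * a.eval t) := by ring
        rw [this]
        exact mul_neg_of_neg_of_pos h (mul_self_pos.2 hat)
      rcases mul_neg_iff.1 hprod with ⟨_, h2⟩ | ⟨h1, _⟩
      · exact Or.inr h2
      · exact Or.inl h1
  -- the finite zero set of `a` and the open set `{a ≠ 0}`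
  have hZfin : {t : ℝ | a.IsRoot t}.Finite := Polynomial.finite_setOf_isRoot ha
  have hopen_a : IsOpen {t : ℝ | a.eval t ≠ 0} := isOpen_ne_fun a.continuous continuous_const
  rcases Set.eq_empty_or_nonempty osc with hempty | ⟨p₀, hp₀⟩
  · rw [hempty, Set.ncard_empty]; exact Nat.zero_le _
  /- (5) FULLY DEGENERATE CASE `U = V = 0`: the positive roots over the sign set near `p₀ 0` are osculation points. -/
  by_cases hdeg : U = 0 ∧ V = 0
  · exfalso
    obtain ⟨hU0, hV0⟩ := hdeg
    obtain ⟨ht₀, -, -, -⟩ := from_osc p₀ hp₀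
    set W : Set ℝ := {t : ℝ | 0 < t} ∩ ({t : ℝ | m.eval t * a.eval t < 0} ∪ ({t : ℝ | δ.eval t * a.eval t < 0} ∪
      {t : ℝ | m.eval t * δ.eval t < 0})) with hW
    have hWopen : IsOpen W :=
      (isOpen_lt continuous_const continuous_id).inter ((isOpen_lt (m.continuous.mul a.continuous)
        continuous_const).union ((isOpen_lt (δ.continuous.mul a.continuous) continuous_const).union
          (isOpen_lt (m.continuous.mul δ.continuous) continuous_const)))
    obtain ⟨t₁, ht₁W, ht₁Z⟩ := exists_mem_open_not_mem_finite hWopen ⟨ht₀, sign_of_mem p₀ hp₀⟩ hZfin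
    have ht₁a : a.eval t₁ ≠ 0 := ht₁Z
    -- a root selector over `{a ≠ 0} ∩ sign set`
    obtain ⟨γ, hγ⟩ : ∃ γ : ℝ → ℝ, ∀ t : ℝ, a.eval t ≠ 0 →
        (m.eval t * a.eval t < 0 ∨ δ.eval t * a.eval t < 0 ∨ m.eval t * δ.eval t < 0) →
        0 < γ t ∧ a.eval t * γ t ^ 2 + m.eval t * γ t + δ.eval t = 0 := by
      refine ⟨fun t => if h : ∃ b : ℝ, 0 < b ∧ a.eval t * b ^ 2 + m.eval t * b + δ.eval t = 0
        then h.choose else 0, fun t hat hsgn => ?_⟩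
      have hex := pos_root_of_sign t hat hsgn
      beta_reduce
      rw [dif_pos hex]
      exact hex.choose_spec
    apply hfin.not_infinite
    refine OsculationCusp.infinite_of_curve (U := W ∩ {t | a.eval t ≠ 0}) (hWopen.inter hopen_a)
      (t₀ := t₁) ⟨ht₁W, ht₁a⟩ γ ?_
    intro t ht
    obtain ⟨⟨htpos, hsgn⟩, hat⟩ := ht
    have hγt := hγ t hat hsgn
    refine mem_of _ ?_ ?_ ?_ ?_ ?_ <;> simp only [Matrix.cons_val_zero, Matrix.cons_val_one]
    exacts [htpos, hγt.1, hat, hγt.2, by rw [hU0, hV0, eval_zero]; ring]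
  /- (6) The two parts of the set. -/
  set O₁ := {p ∈ osc | U.eval (p 0) ≠ 0} with hO₁
  set O₂ := {p ∈ osc | U.eval (p 0) = 0} with hO₂
  have hsplit : osc = O₁ ∪ O₂ := by
    ext p
    simp only [hO₁, hO₂, Set.mem_union, Set.mem_setOf_eq]
    tauto
  -- (6a) `O₁` projects injectively into the positive roots of `N`; if `N ≡ 0` it is empty
  have hO₁card : O₁.ncard ≤ N.support.card := by
    by_cases hN0 : N = 0
    · have hO₁empty : O₁ = ∅ := by
        rcases Set.eq_empty_or_nonempty O₁ with h | ⟨p, hp⟩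
        · exact h
        exfalso
        obtain ⟨hposc, hUp⟩ := hp
        obtain ⟨htp, hbp, -, hl⟩ := from_osc p hposc
        set W : Set ℝ := {t | 0 < t ∧ U.eval t * V.eval t < 0} with hW
        have hWopen : IsOpen W :=
          (isOpen_lt continuous_const continuous_id).inter (isOpen_lt (U.continuous.mul V.continuous) continuous_const)
        have hpW : p 0 ∈ W := by
          refine ⟨htp, ?_⟩
          have hVp : V.eval (p 0) = -(U.eval (p 0) * p 1) := by linarith
          rw [hVp]
          have h2 : 0 < U.eval (p 0) * U.eval (p 0) * p 1 := mul_pos (mul_self_pos.2 hUp) hbp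
          nlinarith
        obtain ⟨t₁, ht₁W, ht₁Z⟩ := exists_mem_open_not_mem_finite hWopen hpW hZfin
        have ht₁a : a.eval t₁ ≠ 0 := ht₁Z
        apply hfin.not_infinite
        refine OsculationCusp.infinite_of_curve (U := W ∩ {t | a.eval t ≠ 0}) (hWopen.inter hopen_a)
          (t₀ := t₁) ⟨ht₁W, ht₁a⟩ (fun t => -(V.eval t) / U.eval t) ?_
        intro t ht
        obtain ⟨⟨htpos, hprod⟩, hat⟩ := ht
        have hUt : U.eval t ≠ 0 := by
          intro h0; rw [h0, zero_mul] at hprod; exact lt_irrefl _ hprod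
        have hcurve : a.eval t * (-(V.eval t) / U.eval t) ^ 2 + m.eval t * (-(V.eval t) / U.eval t) + δ.eval t = 0 := by
          have hNt : N.eval t = 0 := by rw [hN0, eval_zero]
          rw [hN] at hNt
          simp only [eval_sub, eval_add, eval_mul, eval_pow] at hNt
          have hU2 : U.eval t ^ 2 ≠ 0 := pow_ne_zero 2 hUt
          apply mul_left_cancel₀ hU2
          rw [mul_zero]
          have : U.eval t ^ 2 * (a.eval t * (-(V.eval t) / U.eval t) ^ 2 + m.eval t * (-(V.eval t) / U.eval t) + δ.eval t) =
              a.eval t * V.eval t ^ 2 - m.eval t * U.eval t * V.eval t + δ.eval t * U.eval t ^ 2 := by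
            field_simp
            ring
          rw [this]
          linarith
        have hbpos : 0 < -(V.eval t) / U.eval t := by
          have h1 : -(V.eval t) / U.eval t = (-(U.eval t * V.eval t)) / (U.eval t * U.eval t) := by field_simp
          rw [h1]
          exact div_pos (by linarith) (mul_self_pos.2 hUt)
        refine mem_of _ ?_ ?_ ?_ ?_ ?_ <;> simp only [Matrix.cons_val_zero, Matrix.cons_val_one]
        exacts [htpos, hbpos, hat, hcurve, by field_simp; ring]
      rw [hO₁empty, Set.ncard_empty]; exact Nat.zero_le _
    · have hmaps : ∀ p ∈ O₁, (fun p : Fin 2 → ℝ => p 0) p ∈ ((N.roots.toFinset.filter (fun t => 0 < t) : Finset ℝ) : Set ℝ) := by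
        intro p hp
        obtain ⟨htp, -, -, -⟩ := from_osc p hp.1
        simp only [Finset.coe_filter, Set.mem_setOf_eq, Multiset.mem_toFinset]
        exact ⟨(mem_roots hN0).2 (N_root p hp.1), htp⟩
      have hinj : Set.InjOn (fun p : Fin 2 → ℝ => p 0) O₁ := by
        intro p hp q hq hpq
        simp only at hpq
        have h1 := (from_osc p hp.1).2.2.2
        have h2 := (from_osc q hq.1).2.2.2
        rw [← hpq] at h2
        have hb : p 1 = q 1 := by
          have : U.eval (p 0) * (p 1 - q 1) = 0 := by linarith
          rcases mul_eq_zero.1 this with h | h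
          · exact absurd h hp.2
          · linarith
        funext i
        fin_cases i
        exacts [hpq, hb]
      calc O₁.ncard ≤ ((N.roots.toFinset.filter (fun t => 0 < t) : Finset ℝ) : Set ℝ).ncard :=
            Set.ncard_le_ncard_of_injOn _ hmaps hinj (Finset.finite_toSet _)
        _ = (N.roots.toFinset.filter (fun t => 0 < t)).card := Set.ncard_coe_finset _
        _ = (N.roots.filter (fun t => 0 < t)).toFinset.card := by rw [Multiset.toFinset_filter]
        _ ≤ Multiset.card (N.roots.filter (fun t => 0 < t)) := Multiset.toFinset_card_le _
        _ ≤ N.support.card := OsculationRankOne.card_roots_filter_pos_le_card_support N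
  -- (6b) `O₂`: abscissae are common positive roots of `U` and `V`; at most two ordinates each
  have hO₂card : O₂.ncard ≤ 2 * U.support.card + 2 * V.support.card := by
    have key : ∀ (P : ℝ[X]), P ≠ 0 → (∀ p ∈ O₂, P.IsRoot (p 0)) → O₂.ncard ≤ 2 * P.support.card := by
      intro P hP0 hProot
      set TP : Finset ℝ := P.roots.toFinset.filter (fun t => 0 < t) with hTP
      set quad : ℝ → ℝ[X] := fun t => C (a.eval t) * X ^ 2 + C (m.eval t) * X + C (δ.eval t) with hquad
      have hquad_ne : ∀ p ∈ O₂, quad (p 0) ≠ 0 := by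
        intro p hp h0
        apply no_vert p hp.1
        have h2 : (quad (p 0)).coeff 2 = a.eval (p 0) := by rw [hquad]; simp
        have h1 : (quad (p 0)).coeff 1 = m.eval (p 0) := by rw [hquad]; simp [coeff_X_pow, coeff_C]
        rw [h0, coeff_zero] at h2 h1
        exact ⟨h2.symm, h1.symm⟩
      set S : Finset (Fin 2 → ℝ) :=
        TP.biUnion (fun t => ((quad t).roots.toFinset).image (fun b => (![t, b] : Fin 2 → ℝ))) with hS
      have hsub : O₂ ⊆ (S : Set (Fin 2 → ℝ)) := by
        intro p hp
        obtain ⟨htp, -, hΨp, -⟩ := from_osc p hp.1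
        rw [Finset.mem_coe, hS, Finset.mem_biUnion]
        refine ⟨p 0, ?_, ?_⟩
        · rw [hTP, Finset.mem_filter, Multiset.mem_toFinset, mem_roots hP0]
          exact ⟨hProot p hp, htp⟩
        · rw [Finset.mem_image]
          refine ⟨p 1, ?_, ?_⟩
          · rw [Multiset.mem_toFinset, mem_roots (hquad_ne p hp), hquad, IsRoot.def]
            simp only [eval_add, eval_mul, eval_C, eval_pow, eval_X]
            linarith
          · funext i
            fin_cases i <;> rfl
      calc O₂.ncard ≤ (S : Set (Fin 2 → ℝ)).ncard := Set.ncard_le_ncard hsub (Finset.finite_toSet _)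
        _ = S.card := Set.ncard_coe_finset _
        _ ≤ ∑ t ∈ TP, (((quad t).roots.toFinset).image (fun b => (![t, b] : Fin 2 → ℝ))).card :=
            Finset.card_biUnion_le
        _ ≤ ∑ t ∈ TP, 2 := by
            refine Finset.sum_le_sum fun t _ => ?_
            calc _ ≤ ((quad t).roots.toFinset).card := Finset.card_image_le
              _ ≤ Multiset.card (quad t).roots := Multiset.toFinset_card_le _
              _ ≤ (quad t).natDegree := Polynomial.card_roots' _
              _ ≤ 2 := by rw [hquad]; exact Polynomial.natDegree_quadratic_le
        _ = 2 * TP.card := by rw [Finset.sum_const, smul_eq_mul, mul_comm]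
        _ ≤ 2 * P.support.card := by
            apply Nat.mul_le_mul_left
            calc TP.card = (P.roots.filter (fun t => 0 < t)).toFinset.card := by
                  rw [hTP, Multiset.toFinset_filter]
              _ ≤ Multiset.card (P.roots.filter (fun t => 0 < t)) := Multiset.toFinset_card_le _
              _ ≤ P.support.card := OsculationRankOne.card_roots_filter_pos_le_card_support P
    have hVroot : ∀ p ∈ O₂, V.IsRoot (p 0) := by
      intro p hp
      have := (from_osc p hp.1).2.2.2
      rw [hp.2, zero_mul, zero_add] at this
      exact this
    by_cases hU0 : U = 0
    · have hV0 : V ≠ 0 := fun h => hdeg ⟨hU0, h⟩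
      have := key V hV0 hVroot
      omega
    · have := key U hU0 (fun p hp => hp.2)
      omega
  calc osc.ncard = (O₁ ∪ O₂).ncard := by rw [← hsplit]
    _ ≤ O₁.ncard + O₂.ncard := Set.ncard_union_le _ _
    _ ≤ N.support.card + (2 * U.support.card + 2 * V.support.card) := Nat.add_le_add hO₁card hO₂card
    _ = _ := by ring

end OsculationCuspGen

end Summit.ValiantsHypothesis.ValiantsHypothesis.Theorems.LacunarySymmetroidMatrixDescartes
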